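import Literature.NumberTheory.LFunctions.Zhang2022.Section8ResidueEdgeEngine
import Literature.NumberTheory.LFunctions.Zhang2022.Section8Step8u012Prelims
import Literature.NumberTheory.LFunctions.Zhang2022.Section5Lemma52Holds
import Literature.NumberTheory.LFunctions.Zhang2022.Section15Step15u002
import Literature.NumberTheory.LFunctions.Zhang2022.Section8Step8u016

/-!
# Route `ZDegreeToeplitzBand`, crux `PsiGradedTablesClosePoly` (stmt-Parity-22438), line `long_poly_dil`, stub
# `stub_lemma81LongPsiDil` (P2-Dil): the §8 Lemma 8.1 chain RE-RUN AT TWO INDEPENDENT TRUNCATIONS — Part 1,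
# the residue + contour-remainder step (8.1) and the reflection `−Ĩ₁⁻(a₁,a₂) = conj Ĩ₁⁺(ā₂,ā₁)`, for GENERIC data

Y. Zhang, *Discrete mean estimates and the Landau–Siegel zero*, arXiv:2211.02515v1 — an unrefereed manuscript under
adjudication. **The programme SEARCHES and TYPES; no claim about Landau–Siegel zeros, Theorems 1–2 of arXiv:2211.02515
or a repaired Margin232 until a kernel theorem says so.**

The slot `LongLegSplit.Lemma81LongPsiDil c′` (P2-Dil) is Lemma 8.1 with the ψ-side polynomial truncated at `Nlong D` and the
k-side one at `Nsupp D`, for a datum outside (7.2). The tree's kernel chain for `Skeleton.Lemma81` (`Section8aStatements`,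
`Skeleton.lemma81_of_prop22`) is typed at `Apoly = dirPoly (Nsupp D)` and `Adm72` data. This file re-runs its first two steps
for ARBITRARY truncations `N₁, N₂ ≤ P³` and ARBITRARY coefficient sequences bounded by `P¹⁰` (the only properties of the data
the residue theorem and the contour remainder use): with the numerator
`G(s) = −i·[Y(s+β₁)Y(s+β₂)Y(s+β₃)/Y(s)]·L(s+β₂,ψ)L(s+β₃,ψ)·A_{N₁}(a₁;s,ψ)·A_{N₂}(a₂;1−s,ψ̄)` fed to the tree's abstract
engine `Section8aStatements.lratio_residue_edge_of_prop22` (Prop. 2.2 ⇒ admissible rectangle, residue theorem, Lemma 5.9,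
"a simple bound for `ω`"), one gets for every `ψ ∈ Ψ₁`
`Σ_{ρ∈𝔷(ψ)} 𝔠*(ρ,ψ)A_{N₁}(a₁;ρ)A_{N₂}(a₂;1−ρ)ω(ρ) = Ĩ⁺ − Ĩ⁻ + O(e^{−𝓛¹⁰/8})` (`lemma81Ext_residue_edge`), and the
reflection `−Ĩ⁻(a₁,a₂;N₁,N₂) = conj Ĩ⁺(ā₂,ā₁;N₂,N₁)` (`lemma81Ext_reflection`; the truncations swap with the data).
Theorems only; no definitions; no new named facts. Prover: ls-knife-typer-3 g20 (cell landau-siegel §D), `--supports`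
stmt-Parity-22438. [cite: Zhang2022LandauSiegel, §8 Lemma 8.1 pp. 42–43, (8.1)]
-/

noncomputable section

open Complex Real Set ComplexConjugate
open Literature.NumberTheory.LFunctions.Zhang2022
open Literature.NumberTheory.LFunctions.Zhang2022.Skeleton
open Literature.NumberTheory.LFunctions.Zhang2022.Section8aStatements

namespace Summit.Parity.GeneralizedHardyLittlewood.Theorems

/-! ### The numerator `G` of `𝒞̃·A·Ā·ω = (L(s+β₁)/L(s))·G·ω` at two truncations -/

section Numerator

variable (c' : ℝ) {D : ℕ} (x : Chr D)

/-- At a zero `ρ` of `L(s,ψ)` in the upper half-plane, `M′(ρ,ψ) = Y(ρ,ψ)L′(ρ,ψ)` (`M = YL`); copy of the tree's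
`Typed.Section13.deriv_Mfun_eq_of_zero`, kept local to keep the imports of this file small.
[cite: Zhang2022LandauSiegel, §2 p. 5] -/
theorem lemma81Ext_deriv_Mfun_eq_of_zero {ρ : ℂ} (hρ : 0 < ρ.im) (hL : x.ψ.LFunction ρ = 0) :
    deriv (Mfun x.ψ) ρ = Yroot x.ψ ρ * deriv x.ψ.LFunction ρ := by
  have hM : Mfun x.ψ = Yroot x.ψ * x.ψ.LFunction := by funext s; rfl
  have hopen : IsOpen {s : ℂ | 0 < s.im} := isOpen_lt continuous_const Complex.continuous_im
  have hY : DifferentiableAt ℂ (Yroot x.ψ) ρ := (Yroot_spec x.prim).1.differentiableAt (hopen.mem_nhds hρ)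
  have hLd : DifferentiableAt ℂ x.ψ.LFunction ρ :=
    DirichletCharacter.differentiableAt_LFunction x.ψ ρ (Or.inr x.ψ_ne_one)
  rw [hM, deriv_mul hY hLd, hL, mul_zero, zero_add]

/-- **The summand of Lemma 8.1 at a zero is `(L(ρ+β₁)/L′(ρ))·G(ρ)·ω(ρ)`** with
`G = −i[Y₁Y₂Y₃/Y]L(·+β₂)L(·+β₃)·A_{N₁}(a₁;·)·A_{N₂}(a₂;1−·)`: at `ρ` with `Im ρ > 0`, `L(ρ,ψ) = 0`,
`𝔠*(ρ,ψ)·A_{N₁}(a₁;ρ,ψ)A_{N₂}(a₂;1−ρ,ψ̄)·ω(ρ) = (L(ρ+β₁,ψ)/L′(ρ,ψ))·G(ρ)·ω(ρ)` (`𝔠* = −iM₁M₂M₃/M′`, `M = YL`,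
`M′(ρ) = Y(ρ)L′(ρ)`). [cite: Zhang2022LandauSiegel, §2 p. 5 (`𝔠*`), §8 (8.1) p. 42] -/
theorem lemma81Ext_cstar_summand_eq (N₁ N₂ : ℕ) (a₁ a₂ : ℕ → ℂ) {ρ : ℂ} (hρ : 0 < ρ.im)
    (hL : x.ψ.LFunction ρ = 0) :
    cstar c' D x ρ * Lemma81.dirPoly N₁ a₁ x.ψ ρ * Lemma81.dirPoly N₂ a₂ x.ψ⁻¹ (1 - ρ) * omegaW D ρ =
      x.ψ.LFunction (ρ + beta1 c' D) / deriv x.ψ.LFunction ρ *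
        (-I * (Yroot x.ψ (ρ + beta1 c' D) * Yroot x.ψ (ρ + beta2 c' D) * Yroot x.ψ (ρ + beta3 c' D) /
            Yroot x.ψ ρ) *
          (x.ψ.LFunction (ρ + beta2 c' D) * x.ψ.LFunction (ρ + beta3 c' D)) *
          (Lemma81.dirPoly N₁ a₁ x.ψ ρ * Lemma81.dirPoly N₂ a₂ x.ψ⁻¹ (1 - ρ))) * omegaW D ρ := by
  rw [cstar, lemma81Ext_deriv_Mfun_eq_of_zero x hρ hL]
  simp only [Mfun, div_eq_mul_inv, mul_inv]
  ring

/-- **The integrand of `Ĩ₁^{±}` is `(L(s+β₁)/L(s))·G(s)·ω(s)`** with the same `G` (`𝒞̃ = −i[Y₁Y₂Y₃/Y][L₁/L]L₂L₃`,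
the tree's `calCt_eq_prod`). [cite: Zhang2022LandauSiegel, §8 p. 42, tex L2194] -/
theorem lemma81Ext_calCt_integrand_eq (N₁ N₂ : ℕ) (a₁ a₂ : ℕ → ℂ) (s : ℂ) :
    calCt c' x s * (Lemma81.dirPoly N₁ a₁ x.ψ s * Lemma81.dirPoly N₂ a₂ x.ψ⁻¹ (1 - s) * omegaW D s) =
      x.ψ.LFunction (s + beta1 c' D) / x.ψ.LFunction s *
        (-I * (Yroot x.ψ (s + beta1 c' D) * Yroot x.ψ (s + beta2 c' D) * Yroot x.ψ (s + beta3 c' D) /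
            Yroot x.ψ s) *
          (x.ψ.LFunction (s + beta2 c' D) * x.ψ.LFunction (s + beta3 c' D)) *
          (Lemma81.dirPoly N₁ a₁ x.ψ s * Lemma81.dirPoly N₂ a₂ x.ψ⁻¹ (1 - s))) * omegaW D s := by
  rw [calCt_eq_prod]
  ring

/-- **`G` is holomorphic on the upper half-plane** once the shifts have `Im β_j ≥ 0` (`Y(·,ψ)` is holomorphic and
zero-free there, `L`, `A_{N}` are entire). [cite: Zhang2022LandauSiegel, §2 p. 5; §8 (8.1) p. 42] -/
theorem lemma81Ext_G_differentiableOn (N₁ N₂ : ℕ) (a₁ a₂ : ℕ → ℂ) (hb1 : 0 ≤ (beta1 c' D).im)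
    (hb2 : 0 ≤ (beta2 c' D).im) (hb3 : 0 ≤ (beta3 c' D).im) :
    DifferentiableOn ℂ (fun s =>
      -I * (Yroot x.ψ (s + beta1 c' D) * Yroot x.ψ (s + beta2 c' D) * Yroot x.ψ (s + beta3 c' D) /
          Yroot x.ψ s) *
        (x.ψ.LFunction (s + beta2 c' D) * x.ψ.LFunction (s + beta3 c' D)) *
        (Lemma81.dirPoly N₁ a₁ x.ψ s * Lemma81.dirPoly N₂ a₂ x.ψ⁻¹ (1 - s))) {s : ℂ | 0 < s.im} := by
  have hYd : DifferentiableOn ℂ (Yroot x.ψ) {s : ℂ | 0 < s.im} := (Yroot_spec x.prim).1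
  have hshift : ∀ β : ℂ, 0 ≤ β.im →
      DifferentiableOn ℂ (fun s => Yroot x.ψ (s + β)) {s : ℂ | 0 < s.im} := by
    intro β hβ
    refine hYd.comp ((differentiable_id.add_const β).differentiableOn) fun s hs => ?_
    simp only [Set.mem_setOf_eq, Complex.add_im] at hs ⊢
    linarith
  have hLd := DirichletCharacter.differentiable_LFunction x.ψ_ne_one
  have hL2 : Differentiable ℂ fun s => x.ψ.LFunction (s + beta2 c' D) := hLd.comp (differentiable_id.add_const _)
  have hL3 : Differentiable ℂ fun s => x.ψ.LFunction (s + beta3 c' D) := hLd.comp (differentiable_id.add_const _)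
  have hA1 : Differentiable ℂ (Lemma81.dirPoly N₁ a₁ x.ψ) :=
    Section7aStatements.differentiable_dirPoly N₁ a₁ x.ψ x.p_ne_one
  have hA2 : Differentiable ℂ fun s => Lemma81.dirPoly N₂ a₂ x.ψ⁻¹ (1 - s) :=
    (Section7aStatements.differentiable_dirPoly N₂ a₂ x.ψ⁻¹ x.p_ne_one).comp
      ((differentiable_const _).sub differentiable_id)
  have hY0 : ∀ s ∈ {s : ℂ | 0 < s.im}, Yroot x.ψ s ≠ 0 := fun s hs => Step8u012Holds.Yroot_ne_zero x hs
  have hYq : DifferentiableOn ℂ (fun s => Yroot x.ψ (s + beta1 c' D) * Yroot x.ψ (s + beta2 c' D) *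
      Yroot x.ψ (s + beta3 c' D) / Yroot x.ψ s) {s : ℂ | 0 < s.im} :=
    (((hshift _ hb1).mul (hshift _ hb2)).mul (hshift _ hb3)).div hYd hY0
  exact (((differentiableOn_const _).mul hYq).mul (hL2.mul hL3).differentiableOn).mul
    (hA1.mul hA2).differentiableOn


/-- **The size of `G` on the boundary zone** `|σ − ½| ≤ α`, `|t − 2πt₀| ≤ 𝓛₁ + ¼` (`𝓛 ≥ 80`, `5π|c′|+1 ≤ 𝓛`,
`|C₅₂| + 15 ≤ 𝓛`): with Lemma 5.2's comparison at `s` (`|Y₁Y₂Y₃/Y| ≤ (|C₅₂|+1)e¹⁴`, via `|(pt₀)^{β₃}Z(s)⁻¹| ≤ e¹⁴`), the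
convexity bound `|L(s+β_{2,3},ψ)| ≤ 4p³ζ(5/4)(9𝓛⁵¹⁹)³`, and the trivial bounds `|A_{N}(a;·)| ≤ N·M` for `Re ≥ 0`,
`‖G(s)‖ ≤ e^{3200·𝓛⁹}` whenever `N₁, N₂ ≤ P³` and `|a₁|, |a₂| ≤ P¹⁰`. [cite: Zhang2022LandauSiegel, §8 (8.1) p. 42; §5 Lemma 5.2] -/
theorem lemma81Ext_norm_G_le {C₅₂ : ℝ} (h80 : 80 ≤ ell D) (hc : 5 * π * |c'| + 1 ≤ ell D)
    (hC : |C₅₂| + 15 ≤ ell D)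
    (hZc : 4 * 27 * 729 * (∑' n : ℕ, ((n + 1 : ℕ) : ℝ) ^ (-(5 / 4 : ℝ))) + 1 ≤ ell D)
    {N₁ N₂ : ℕ} {a₁ a₂ : ℕ → ℂ}
    (hN₁ : (N₁ : ℝ) ≤ bigP D ^ 3) (hN₂ : (N₂ : ℝ) ≤ bigP D ^ 3)
    (ha₁ : ∀ n, ‖a₁ n‖ ≤ bigP D ^ 10) (ha₂ : ∀ n, ‖a₂ n‖ ≤ bigP D ^ 10) {s : ℂ}
    (hσ : |s.re - 1 / 2| ≤ alpha D) (ht2 : |s.im - 2 * π * t0 D| ≤ ell1 D + 1 / 4)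
    (h52 : ‖Yroot x.ψ (s + beta1 c' D) * Yroot x.ψ (s + beta2 c' D) * Yroot x.ψ (s + beta3 c' D) /
          Yroot x.ψ s - (((x.p : ℝ) * t0 D : ℝ) : ℂ) ^ beta3 c' D * (GammaFactor.Zfac x.ψ s)⁻¹‖
        ≤ C₅₂ * (ell D ^ 123)⁻¹ * ‖(((x.p : ℝ) * t0 D : ℝ) : ℂ) ^ beta3 c' D * (GammaFactor.Zfac x.ψ s)⁻¹‖) :
    ‖-I * (Yroot x.ψ (s + beta1 c' D) * Yroot x.ψ (s + beta2 c' D) * Yroot x.ψ (s + beta3 c' D) /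
          Yroot x.ψ s) *
        (x.ψ.LFunction (s + beta2 c' D) * x.ψ.LFunction (s + beta3 c' D)) *
        (Lemma81.dirPoly N₁ a₁ x.ψ s * Lemma81.dirPoly N₂ a₂ x.ψ⁻¹ (1 - s))‖ ≤
      Real.exp (3200 * ell D ^ 9) := by
  have hL1 : 1 ≤ ell D := by linarith
  have hL3 : 3 ≤ ell D := by linarith
  obtain ⟨hα0, hα6, hα1⟩ := Step8u016.alpha_small hL3
  have hα_eq : alpha D = π / ell D ^ 9 := by rw [alpha, bigP, Real.log_exp]
  have hα4 : alpha D ≤ 1 / 100 := by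
    rw [hα_eq, div_le_iff₀ (by positivity)]
    have h9 : (80 : ℝ) ^ 2 ≤ ell D ^ 9 := by
      calc (80 : ℝ) ^ 2 ≤ ell D ^ 2 := pow_le_pow_left₀ (by norm_num) h80 2
        _ ≤ ell D ^ 9 := pow_le_pow_right₀ hL1 (by norm_num)
    nlinarith [Real.pi_lt_four]
  obtain ⟨hb1, hb2, hb3, -, -, -⟩ := shift_sizes_of_ell h80 hc
  have h4α : 4 * alpha D ≤ 1 := by linarith
  obtain ⟨e1, e2, e3⟩ := beta_eq_b_mul_I c' D
  set Zc : ℝ := ∑' n : ℕ, ((n + 1 : ℕ) : ℝ) ^ (-(5 / 4 : ℝ)) with hZcdef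
  have hZc0 : 0 ≤ Zc := tsum_nonneg fun n => by positivity
  -- (1) the `Y`-quotient: `≤ (|C₅₂|+1)e¹⁴`
  have ht0pos : 0 < t0 D := by rw [t0]; positivity
  have hmain : ‖(((x.p : ℝ) * t0 D : ℝ) : ℂ) ^ beta3 c' D * (GammaFactor.Zfac x.ψ s)⁻¹‖ ≤ Real.exp 14 := by
    rw [norm_mul, Step8u012Holds.norm_cpow_beta3 (c' := c') x ht0pos, one_mul]
    have hs : s = ((s.re : ℝ) : ℂ) + (s.im : ℝ) * I := (Complex.re_add_im s).symm
    rw [hs]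
    exact norm_inv_Zfac_le_exp14 hL3 x (by linarith [hσ]) (by linarith [ht2])
  have hY : ‖Yroot x.ψ (s + beta1 c' D) * Yroot x.ψ (s + beta2 c' D) * Yroot x.ψ (s + beta3 c' D) /
      Yroot x.ψ s‖ ≤ (|C₅₂| + 1) * Real.exp 14 := by
    set Yq := Yroot x.ψ (s + beta1 c' D) * Yroot x.ψ (s + beta2 c' D) * Yroot x.ψ (s + beta3 c' D) /
      Yroot x.ψ s
    set mn := (((x.p : ℝ) * t0 D : ℝ) : ℂ) ^ beta3 c' D * (GammaFactor.Zfac x.ψ s)⁻¹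
    have h123 : (ell D ^ 123)⁻¹ ≤ 1 := inv_le_one_of_one_le₀ (one_le_pow₀ hL1)
    have hi0 : 0 ≤ (ell D ^ 123)⁻¹ := by positivity
    have hcoef : C₅₂ * (ell D ^ 123)⁻¹ + 1 ≤ |C₅₂| + 1 := by
      have : C₅₂ * (ell D ^ 123)⁻¹ ≤ |C₅₂| * 1 :=
        (mul_le_mul_of_nonneg_right (le_abs_self _) hi0).trans (mul_le_mul_of_nonneg_left h123 (abs_nonneg _))
      linarith
    calc ‖Yq‖ = ‖(Yq - mn) + mn‖ := by rw [sub_add_cancel]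
      _ ≤ ‖Yq - mn‖ + ‖mn‖ := norm_add_le _ _
      _ ≤ C₅₂ * (ell D ^ 123)⁻¹ * ‖mn‖ + ‖mn‖ := by linarith [h52]
      _ = (C₅₂ * (ell D ^ 123)⁻¹ + 1) * ‖mn‖ := by ring
      _ ≤ (|C₅₂| + 1) * Real.exp 14 := mul_le_mul hcoef hmain (norm_nonneg _) (by positivity)
  -- (2) the two `L`-values
  have hσ4 : |s.re - 1 / 2| ≤ 1 / 4 := hσ.trans (by linarith)
  have ht1 : |s.im - 2 * π * t0 D| ≤ ell1 D + 1 := ht2.trans (by linarith)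
  have hL2v : ‖x.ψ.LFunction (s + beta2 c' D)‖ ≤ 4 * (x.p : ℝ) ^ 3 * Zc * (9 * ell D ^ 519) ^ 3 := by
    rw [e2]; exact Typed.Section15A.norm_LFunction_shift_le_zone h80 x (hb2.trans h4α) hσ4 ht1
  have hL3v : ‖x.ψ.LFunction (s + beta3 c' D)‖ ≤ 4 * (x.p : ℝ) ^ 3 * Zc * (9 * ell D ^ 519) ^ 3 := by
    rw [e3]; exact Typed.Section15A.norm_LFunction_shift_le_zone h80 x (hb3.trans h4α) hσ4 ht1
  -- (3) the Dirichlet polynomials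
  obtain ⟨hs1, hs2⟩ := abs_le.mp hσ
  have hP0 : 0 < bigP D := Real.exp_pos _
  have hP1 : 1 ≤ bigP D := by rw [bigP]; exact Real.one_le_exp (by positivity)
  have hA1 : ‖Lemma81.dirPoly N₁ a₁ x.ψ s‖ ≤ N₁ * bigP D ^ 10 :=
    norm_dirPoly_le_mul x.p_ne_one N₁ ha₁ x.ψ (by linarith)
  have hA2 : ‖Lemma81.dirPoly N₂ a₂ x.ψ⁻¹ (1 - s)‖ ≤ N₂ * bigP D ^ 10 :=
    norm_dirPoly_le_mul x.p_ne_one N₂ ha₂ x.ψ⁻¹ (by simp only [sub_re, one_re]; linarith)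
  -- (4) exponential envelopes of the factors
  have hp3 : (x.p : ℝ) ≤ 3 * bigP D := Step8u016.chr_p_le_three_bigP hL3 x
  have hp0 : (0 : ℝ) ≤ x.p := Nat.cast_nonneg _
  have hexpP : bigP D = Real.exp (ell D ^ 9) := rfl
  have hL9 : 1 ≤ ell D ^ 9 := one_le_pow₀ hL1
  have hLle9 : ell D ≤ ell D ^ 9 := le_self_pow₀ hL1 (by norm_num)
  -- `(|C₅₂|+1)e¹⁴ ≤ e^{𝓛⁹}`
  have hE1 : (|C₅₂| + 1) * Real.exp 14 ≤ Real.exp (ell D ^ 9) := by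
    have h1 : |C₅₂| + 1 ≤ Real.exp (|C₅₂| + 1) := by linarith [Real.add_one_le_exp (|C₅₂| + 1)]
    calc (|C₅₂| + 1) * Real.exp 14 ≤ Real.exp (|C₅₂| + 1) * Real.exp 14 :=
          mul_le_mul_of_nonneg_right h1 (Real.exp_pos _).le
      _ = Real.exp (|C₅₂| + 15) := by rw [← Real.exp_add]; ring_nf
      _ ≤ Real.exp (ell D ^ 9) := Real.exp_le_exp.mpr (hC.trans hLle9)
  -- `4p³Zc(9𝓛⁵¹⁹)³ ≤ e^{177𝓛⁹}`
  have hE2 : 4 * (x.p : ℝ) ^ 3 * Zc * (9 * ell D ^ 519) ^ 3 ≤ Real.exp (177 * ell D ^ 9) := by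
    have h1 : (x.p : ℝ) ^ 3 ≤ 27 * bigP D ^ 3 := by
      calc (x.p : ℝ) ^ 3 ≤ (3 * bigP D) ^ 3 := pow_le_pow_left₀ hp0 hp3 3
        _ = 27 * bigP D ^ 3 := by ring
    have h2 : (9 * ell D ^ 519) ^ 3 = 729 * (ell D ^ 9) ^ 173 := by ring
    have h3 : (ell D ^ 9) ^ 173 ≤ Real.exp (ell D ^ 9) ^ 173 :=
      pow_le_pow_left₀ (by positivity) (by linarith [Real.add_one_le_exp (ell D ^ 9)]) 173
    have h4 : 4 * 27 * 729 * Zc ≤ Real.exp (ell D ^ 9) := by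
      have : 4 * 27 * 729 * Zc ≤ ell D := by linarith
      exact this.trans (hLle9.trans (by linarith [Real.add_one_le_exp (ell D ^ 9)]))
    calc 4 * (x.p : ℝ) ^ 3 * Zc * (9 * ell D ^ 519) ^ 3
        ≤ 4 * (27 * bigP D ^ 3) * Zc * (729 * (ell D ^ 9) ^ 173) := by rw [h2]; gcongr
      _ = (4 * 27 * 729 * Zc) * bigP D ^ 3 * (ell D ^ 9) ^ 173 := by ring
      _ ≤ Real.exp (ell D ^ 9) * Real.exp (ell D ^ 9) ^ 3 * Real.exp (ell D ^ 9) ^ 173 := by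
          rw [hexpP]; gcongr
      _ = Real.exp (177 * ell D ^ 9) := by
          rw [← Real.exp_nat_mul, ← Real.exp_nat_mul, ← Real.exp_add, ← Real.exp_add]; ring_nf
  -- `N·P¹⁰ ≤ e^{13𝓛⁹}`
  have hE3 : ∀ N : ℕ, (N : ℝ) ≤ bigP D ^ 3 → (N : ℝ) * bigP D ^ 10 ≤ Real.exp (13 * ell D ^ 9) := by
    intro N hN
    calc (N : ℝ) * bigP D ^ 10 ≤ bigP D ^ 3 * bigP D ^ 10 := by gcongr
      _ = Real.exp (13 * ell D ^ 9) := by rw [hexpP, ← pow_add, ← Real.exp_nat_mul]; norm_num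
  -- assemble
  have hsplit : ‖-I * (Yroot x.ψ (s + beta1 c' D) * Yroot x.ψ (s + beta2 c' D) * Yroot x.ψ (s + beta3 c' D) /
          Yroot x.ψ s) *
        (x.ψ.LFunction (s + beta2 c' D) * x.ψ.LFunction (s + beta3 c' D)) *
        (Lemma81.dirPoly N₁ a₁ x.ψ s * Lemma81.dirPoly N₂ a₂ x.ψ⁻¹ (1 - s))‖ =
      ‖Yroot x.ψ (s + beta1 c' D) * Yroot x.ψ (s + beta2 c' D) * Yroot x.ψ (s + beta3 c' D) / Yroot x.ψ s‖ *
        (‖x.ψ.LFunction (s + beta2 c' D)‖ * ‖x.ψ.LFunction (s + beta3 c' D)‖) *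
        (‖Lemma81.dirPoly N₁ a₁ x.ψ s‖ * ‖Lemma81.dirPoly N₂ a₂ x.ψ⁻¹ (1 - s)‖) := by
    simp only [norm_mul, norm_neg, Complex.norm_I, one_mul]
  rw [hsplit]
  calc ‖Yroot x.ψ (s + beta1 c' D) * Yroot x.ψ (s + beta2 c' D) * Yroot x.ψ (s + beta3 c' D) / Yroot x.ψ s‖ *
        (‖x.ψ.LFunction (s + beta2 c' D)‖ * ‖x.ψ.LFunction (s + beta3 c' D)‖) *
        (‖Lemma81.dirPoly N₁ a₁ x.ψ s‖ * ‖Lemma81.dirPoly N₂ a₂ x.ψ⁻¹ (1 - s)‖)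
      ≤ Real.exp (ell D ^ 9) * (Real.exp (177 * ell D ^ 9) * Real.exp (177 * ell D ^ 9)) *
        (Real.exp (13 * ell D ^ 9) * Real.exp (13 * ell D ^ 9)) := by
        gcongr
        · exact hY.trans hE1
        · exact hL2v.trans hE2
        · exact hL3v.trans hE2
        · exact hA1.trans (hE3 N₁ hN₁)
        · exact hA2.trans (hE3 N₂ hN₂)
    _ = Real.exp (381 * ell D ^ 9) := by
        rw [← Real.exp_add, ← Real.exp_add, ← Real.exp_add, ← Real.exp_add]; ring_nf
    _ ≤ Real.exp (3200 * ell D ^ 9) := Real.exp_le_exp.mpr (by nlinarith)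

end Numerator

/-! ### (8.1) at two truncations: residues + contour remainder, via the tree's abstract engine -/

section EightOne

variable {c' : ℝ}

/-- **(8.1) AT TWO INDEPENDENT TRUNCATIONS, for generic data** ("By Proposition 2.2 … by Lemma 5.9, the residue theorem
and a simple bound for `ω(s)`", abstract engine `lratio_residue_edge_of_prop22` at the numerator `G` above): for `c′ ≥ 0`
with `Prop22 c′` there is `C′` such that for all large `D`, under (A), for every `ψ ∈ Ψ₁`, all truncations
`N₁, N₂ ≤ P³` and all coefficient sequences bounded by `P¹⁰`,
`‖Σ_{ρ∈𝔷(ψ)} 𝔠*(ρ,ψ)A_{N₁}(a₁;ρ,ψ)A_{N₂}(a₂;1−ρ,ψ̄)ω(ρ) − (Ĩ⁺ − Ĩ⁻)‖ ≤ C′e^{−𝓛¹⁰/8}`, where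
`Ĩ^{±} = (1/2πi)∫_{𝔍(±α)} 𝒞̃(s,ψ)A_{N₁}(a₁;s,ψ)A_{N₂}(a₂;1−s,ψ̄)ω(s)ds`. [cite: Zhang2022LandauSiegel, §8 (8.1) p. 42] -/
theorem lemma81Ext_residue_edge (hc' : 0 ≤ c') (h22 : Prop22 c') :
    ∃ C' : ℝ, ForAllLarge fun D _ χ => AssumptionA D χ → ∀ x ∈ PsiOne χ,
      ∀ (N₁ N₂ : ℕ) (a₁ a₂ : ℕ → ℂ), (N₁ : ℝ) ≤ bigP D ^ 3 → (N₂ : ℝ) ≤ bigP D ^ 3 →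
      (∀ n, ‖a₁ n‖ ≤ bigP D ^ 10) → (∀ n, ‖a₂ n‖ ≤ bigP D ^ 10) →
      ‖(∑ ρ ∈ finsetOf (zeroSet D x),
            cstar c' D x ρ * Lemma81.dirPoly N₁ a₁ x.ψ ρ * Lemma81.dirPoly N₂ a₂ x.ψ⁻¹ (1 - ρ) * omegaW D ρ) -
          (Lemma81.segInt (t0 D) (ell1 D) ((alpha D : ℝ) : ℂ) (fun s => calCt c' x s *
              (Lemma81.dirPoly N₁ a₁ x.ψ s * Lemma81.dirPoly N₂ a₂ x.ψ⁻¹ (1 - s) * omegaW D s)) -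
            Lemma81.segInt (t0 D) (ell1 D) ((-alpha D : ℝ) : ℂ) (fun s => calCt c' x s *
              (Lemma81.dirPoly N₁ a₁ x.ψ s * Lemma81.dirPoly N₂ a₂ x.ψ⁻¹ (1 - s) * omegaW D s)))‖ ≤
        C' * Real.exp (-(ell D ^ 10 / 8)) := by
  obtain ⟨C', D₁, heng⟩ := lratio_residue_edge_of_prop22 hc' h22 3200
  obtain ⟨C₅₂, D₅₂, h52⟩ := lemma52_holds c'
  set L₀ : ℝ := max 80 (max (5 * π * |c'| + 1) (max (|C₅₂| + 15)
    (4 * 27 * 729 * (∑' n : ℕ, ((n + 1 : ℕ) : ℝ) ^ (-(5 / 4 : ℝ))) + 1))) with hL₀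
  refine ⟨C', max (max D₁ D₅₂) ⌈Real.exp L₀⌉₊, ?_⟩
  intro D _ χ hD hq hp hA x hx N₁ N₂ a₁ a₂ hN₁ hN₂ ha₁ ha₂
  have hD1 : D₁ ≤ D := le_trans (le_trans (le_max_left _ _) (le_max_left _ _)) hD
  have hD52 : D₅₂ ≤ D := le_trans (le_trans (le_max_right _ _) (le_max_left _ _)) hD
  have hL : L₀ ≤ ell D := Section4.le_ell_of_ceil_exp_le (le_trans (le_max_right _ _) hD)
  have h80 : 80 ≤ ell D := (le_max_left _ _).trans hL
  have hcL : 5 * π * |c'| + 1 ≤ ell D := ((le_max_left _ _).trans (le_max_right _ _)).trans hL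
  have hCL : |C₅₂| + 15 ≤ ell D :=
    (((le_max_left _ _).trans (le_max_right _ _)).trans (le_max_right _ _)).trans hL
  have hZL : 4 * 27 * 729 * (∑' n : ℕ, ((n + 1 : ℕ) : ℝ) ^ (-(5 / 4 : ℝ))) + 1 ≤ ell D :=
    (((le_max_right _ _).trans (le_max_right _ _)).trans (le_max_right _ _)).trans hL
  obtain ⟨-, -, -, hb1, hb2, hb3⟩ := shift_sizes_of_ell h80 hcL
  have hℓ1t0 : ell1 D < 2 * π * t0 D := (Step8u016.window_sizes (by linarith)).1
  -- the numerator and its two properties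
  set G : ℂ → ℂ := fun s =>
    -I * (Yroot x.ψ (s + beta1 c' D) * Yroot x.ψ (s + beta2 c' D) * Yroot x.ψ (s + beta3 c' D) /
        Yroot x.ψ s) *
      (x.ψ.LFunction (s + beta2 c' D) * x.ψ.LFunction (s + beta3 c' D)) *
      (Lemma81.dirPoly N₁ a₁ x.ψ s * Lemma81.dirPoly N₂ a₂ x.ψ⁻¹ (1 - s)) with hGdef
  have hG : DifferentiableOn ℂ G {s : ℂ | 0 < s.im} :=
    lemma81Ext_G_differentiableOn c' x N₁ N₂ a₁ a₂ hb1 hb2 hb3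
  have hGb : ∀ s : ℂ, |s.re - 1 / 2| ≤ alpha D → ell1 D - 1 ≤ |s.im - 2 * π * t0 D| →
      |s.im - 2 * π * t0 D| ≤ ell1 D + 1 / 4 → ‖G s‖ ≤ Real.exp (3200 * ell D ^ 9) := by
    intro s hσ _ ht2
    have h52s := h52 D χ hD52 hq hp x s ⟨hσ, by linarith⟩
    exact lemma81Ext_norm_G_le c' x h80 hcL hCL hZL hN₁ hN₂ ha₁ ha₂ hσ ht2 h52s
  have key := heng D χ hD1 hq hp hA x hx G hG hGb
  -- rewrite the three pieces
  have hsum : (∑ ρ ∈ finsetOf (zeroSet D x),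
      cstar c' D x ρ * Lemma81.dirPoly N₁ a₁ x.ψ ρ * Lemma81.dirPoly N₂ a₂ x.ψ⁻¹ (1 - ρ) * omegaW D ρ) =
      ∑ ρ ∈ finsetOf (zeroSet D x),
        x.ψ.LFunction (ρ + beta1 c' D) / deriv x.ψ.LFunction ρ * G ρ * omegaW D ρ := by
    refine Finset.sum_congr rfl fun ρ hρ => ?_
    have hρ' : ρ ∈ zeroSet D x := mem_of_mem_finsetOf hρ
    obtain ⟨-, hρim, hρL⟩ := hρ'
    have hρpos : 0 < ρ.im := by
      have := (abs_lt.mp hρim).1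
      linarith
    rw [lemma81Ext_cstar_summand_eq c' x N₁ N₂ a₁ a₂ hρpos hρL]
  have hint : (fun s => calCt c' x s *
      (Lemma81.dirPoly N₁ a₁ x.ψ s * Lemma81.dirPoly N₂ a₂ x.ψ⁻¹ (1 - s) * omegaW D s)) =
      fun s => x.ψ.LFunction (s + beta1 c' D) / x.ψ.LFunction s * G s * omegaW D s := by
    funext s
    rw [lemma81Ext_calCt_integrand_eq c' x N₁ N₂ a₁ a₂ s]
  rw [hsum, hint]
  exact key

end EightOne

/-! ### The reflection `−Ĩ⁻(a₁,a₂;N₁,N₂) = conj Ĩ⁺(ā₂,ā₁;N₂,N₁)` at two truncations -/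

section Reflection

/-- Conjugation commutes with the interval integral. [folklore] -/
private theorem conj_intervalIntegral' (f : ℝ → ℂ) (a b : ℝ) :
    conj (∫ v in a..b, f v) = ∫ v in a..b, conj (f v) := by
  simp only [intervalIntegral, map_sub, integral_conj]

variable (c' : ℝ)

/-- **"These together imply that `−Ĩ₁⁻(𝐚₁,𝐚₂;ψ) = conj Ĩ₁⁺(ā₂,ā₁;ψ)`" AT TWO TRUNCATIONS** (Z22:§8.u006–u009): for all
large `D`, every `ψ ∈ Ψ`, all `N₁, N₂, a₁, a₂`,
`−(1/2πi)∫_{𝔍(−α)} 𝒞̃·A_{N₁}(a₁;s)A_{N₂}(a₂;1−s)ω = conj (1/2πi)∫_{𝔍(α)} 𝒞̃·A_{N₂}(ā₂;s)A_{N₁}(ā₁;1−s)ω` — the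
truncations travel with the data. Pointwise: `conj 𝒞̃(s) = −𝒞̃(s′)` (`step8u007_holds`), `conj A_N(ā;s,ψ) = A_N(a;s̄,ψ̄)`
(`Lemma81.conj_dirPoly`), `conj ω(s) = ω(s′)` (`Lemma81.conj_omega`), `s′ = 1 − s̄ ∈ 𝔍(−α)` (`Lemma81.one_sub_conj_eq`).
[cite: Zhang2022LandauSiegel, §8 p. 43, tex L2215–2230] -/
theorem lemma81Ext_reflection :
    ForAllLarge fun D _ _ => ∀ (x : Chr D) (N₁ N₂ : ℕ) (a₁ a₂ : ℕ → ℂ),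
      -Lemma81.segInt (t0 D) (ell1 D) ((-alpha D : ℝ) : ℂ) (fun s => calCt c' x s *
          (Lemma81.dirPoly N₁ a₁ x.ψ s * Lemma81.dirPoly N₂ a₂ x.ψ⁻¹ (1 - s) * omegaW D s)) =
        conj (Lemma81.segInt (t0 D) (ell1 D) ((alpha D : ℝ) : ℂ) (fun s => calCt c' x s *
          (Lemma81.dirPoly N₂ (fun n => conj (a₂ n)) x.ψ s *
            Lemma81.dirPoly N₁ (fun n => conj (a₁ n)) x.ψ⁻¹ (1 - s) * omegaW D s))) := by
  obtain ⟨D₀, h7⟩ := step8u007_holds c'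
  refine ⟨D₀, fun D _ χ hD hq hp x N₁ N₂ a₁ a₂ => ?_⟩
  have h7x := h7 D χ hD hq hp x
  rw [Lemma81.segInt_def, Lemma81.segInt_def, map_mul, conj_intervalIntegral',
    show conj (1 / (2 * π) : ℂ) = 1 / (2 * π) by
      rw [map_div₀, map_one, map_mul, map_ofNat, Complex.conj_ofReal],
    ← mul_neg, ← intervalIntegral.integral_neg]
  congr 1
  refine intervalIntegral.integral_congr fun v hv => ?_
  have hvabs : |v| ≤ ell1 D := by
    have hℓ : 0 ≤ ell1 D := by rw [ell1]; exact pow_nonneg (Real.log_natCast_nonneg D) _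
    rw [Set.uIcc_of_le (by linarith)] at hv
    exact abs_le.mpr ⟨hv.1, hv.2⟩
  have honJ : onJ D (alpha D) (((alpha D : ℝ) : ℂ) + SmoothWeight.s0 (t0 D) + v * I) := ⟨v, hvabs, rfl⟩
  have hC : conj (calCt c' x (((alpha D : ℝ) : ℂ) + SmoothWeight.s0 (t0 D) + v * I)) =
      -calCt c' x (1 - conj (((alpha D : ℝ) : ℂ) + SmoothWeight.s0 (t0 D) + v * I)) := h7x _ honJ
  have hs' : 1 - conj (((alpha D : ℝ) : ℂ) + SmoothWeight.s0 (t0 D) + v * I) =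
      ((-alpha D : ℝ) : ℂ) + SmoothWeight.s0 (t0 D) + v * I :=
    Lemma81.one_sub_conj_eq (t0 D) (alpha D) v
  have hω : conj (omegaW D (((alpha D : ℝ) : ℂ) + SmoothWeight.s0 (t0 D) + v * I)) =
      omegaW D (1 - conj (((alpha D : ℝ) : ℂ) + SmoothWeight.s0 (t0 D) + v * I)) :=
    Lemma81.conj_omega (ell2 D) (t0 D) _
  have ha₁ : (fun n => conj ((fun n => conj (a₁ n)) n)) = a₁ := funext fun n => Complex.conj_conj _
  have ha₂ : (fun n => conj ((fun n => conj (a₂ n)) n)) = a₂ := funext fun n => Complex.conj_conj _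
  have hcs : conj (((alpha D : ℝ) : ℂ) + SmoothWeight.s0 (t0 D) + v * I) =
      1 - (((-alpha D : ℝ) : ℂ) + SmoothWeight.s0 (t0 D) + v * I) := by
    rw [← hs']; ring
  rw [map_mul, map_mul, map_mul, hC, Lemma81.conj_dirPoly, Lemma81.conj_dirPoly, inv_inv, hω, ha₁, ha₂,
    map_sub, map_one, hs', hcs]
  ring

end Reflection

end Summit.Parity.GeneralizedHardyLittlewood.Theorems

end
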